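import Mathlib
import Summits.AtomisticToContinuum.Crystallization.Theorems.BraggSlacknessRigidityHcpDiffractionRigidityEssentialPeriodicityRatAux6

/-!
# Essential periodicity from quietness, periods and arithmetic (stub
# `stub_essentialPeriodicityOfArith` of crux `HcpDiffractionRigidity`,
# item `stmt-AtomisticToContinuum-13166`, Aux file 7)

Let `Λ ⊆ ℝ³` be `r`-separated and *Gaussian-quiet* along scales `L t → ∞` off the Bragg set `Z`
of a periodic template `P`, let `V` be a set of periods of `|S_t|²` (`⟨m, s⟩ ∈ ℤ` for `m ∈ V`,
`s ∈ Λ`), and let `z₀` be a vector such that the non-zero vectors `p - q - z₀` (`p, q ∈ Λ`) have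
norm `≥ r` and such that `⟨ξ, z₀⟩ ∈ ℤ` for every `ξ` of the *periodised Bragg set*
`K = {ξ : ξ + V ⊆ Z}`.  Then the squared-Gaussian mass of `{s ∈ Λ : s + z₀ ∉ Λ}` is
`o(`squared-Gaussian mass`)`:

* `tendsto_bad_div_mass` — the per-vector theorem;
* `stub_essentialPeriodicityOfArith` — the lattice form used by the skeleton: if `Λ ⊆ M`,
  `M` a discrete `ℤ`-module, and every `ξ ∈ K` pairs `(1/k)`-integrally with `M`, then `Λ` is
  essentially periodic under `M' = k • M`.

Proof: choose `A` (`τ(r,A) ≤ ε/16`), `B = √2 A`, then `R` (Gaussian tail), then `ρ` (width of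
the neighbourhood of `K`, where the modulation `1 − cos 2π⟨ξ,z₀⟩` vanishes to second order);
a cutoff `χ` equal to `1` on `{|ξ| ≤ R} ∖ K_ρ` with support off `K` makes `gA χ` quiet
(Aux file 5); the bound at one scale (Aux file 6) gives `BAD ≤ (ε/2) MG` eventually.

All `[folklore]`.
-/

noncomputable section

namespace Summit.AtomisticToContinuum.Crystallization.Theorems

namespace HcpRigiditySpectral

open MeasureTheory Complex Filter Metric Set
open scoped BigOperators Real RealInnerProductSpace Topology Classical
open Literature.MathematicalPhysics.StatisticalMechanics
open Summit.AtomisticToContinuum.Crystallization.Theorems.HcpRigidityDenseCentres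
open Summit.AtomisticToContinuum.Crystallization.Theorems.HcpRigidityWindows
open Summit.AtomisticToContinuum.Crystallization.Theorems.HcpRigidityLocalLimit

/-! ## The per-vector theorem -/

/-- **Essential periodicity in one direction.** Let `Λ ⊆ ℝ³` be `r`-separated and Gaussian-quiet
along `L t → ∞` for the admissible test functions of the template `P`; let `V` be a set of
periods (`⟨m, s⟩ ∈ ℤ`, `m ∈ V`, `s ∈ Λ`), and `z₀` a vector such that the non-zero `p - q - z₀`
(`p, q ∈ Λ`) have norm `≥ r` and `⟨ξ, z₀⟩ ∈ ℤ` whenever all `V`-translates of `ξ` lie in the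
Bragg set. Then `BAD_t(z₀)/MG_t → 0`, where `BAD_t(z₀)` is the squared-Gaussian mass of
`{s ∈ Λ : s + z₀ ∉ Λ}` and `MG_t` the total squared-Gaussian mass. [folklore] -/
theorem tendsto_bad_div_mass {P : PeriodicConfiguration 3} {Λ : Set (EuclideanSpace ℝ (Fin 3))}
    {r : ℝ} (hr : 0 < r) (hΛ : ∀ p ∈ Λ, ∀ q ∈ Λ, p ≠ q → r ≤ dist p q) {L : ℕ → ℝ}
    (hL : Tendsto L atTop atTop)
    (hquiet : ∀ g : EuclideanSpace ℝ (Fin 3) → ℝ, Continuous g → HasCompactSupport g →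
      (∀ ξ ∈ tsupport g, ξ ≠ 0 ∧ ∀ k : EuclideanSpace ℝ (Fin 3),
        (∀ v ∈ P.lattice, ∃ n : ℤ, ⟪k, v⟫ = (n : ℝ)) → ‖ξ‖ ≠ ‖k‖) →
      ∀ ε : ℝ, 0 < ε → ∀ᶠ t : ℕ in atTop,
        (∫ ξ : EuclideanSpace ℝ (Fin 3), g ξ *
          ‖∑' s : Λ, (Real.exp (-(‖(s : EuclideanSpace ℝ (Fin 3))‖ ^ 2) / L t ^ 2) : ℂ) *
            cexp (2 * Real.pi * I * (⟪ξ, (s : EuclideanSpace ℝ (Fin 3))⟫ : ℂ))‖ ^ 2) ≤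
        ε * ∑' s : Λ, Real.exp (-(‖(s : EuclideanSpace ℝ (Fin 3))‖ ^ 2) / L t ^ 2) ^ 2)
    {V : Set (EuclideanSpace ℝ (Fin 3))} (hV : ∀ m ∈ V, ∀ s ∈ Λ, ∃ n : ℤ, ⟪m, s⟫ = (n : ℝ))
    {z₀ : EuclideanSpace ℝ (Fin 3)} (hz₀ : ∀ p ∈ Λ, ∀ q ∈ Λ, p - q - z₀ ≠ 0 → r ≤ ‖p - q - z₀‖)
    (harith : ∀ ξ : EuclideanSpace ℝ (Fin 3), (∀ m ∈ V, ¬ (ξ + m ≠ 0 ∧ ∀ k : EuclideanSpace ℝ (Fin 3),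
      (∀ v ∈ P.lattice, ∃ n : ℤ, ⟪k, v⟫ = (n : ℝ)) → ‖ξ + m‖ ≠ ‖k‖)) → ∃ n : ℤ, ⟪ξ, z₀⟫ = n) :
    Tendsto (fun t : ℕ => (∑' s : Λ, if (s : EuclideanSpace ℝ (Fin 3)) + z₀ ∈ Λ then (0 : ℝ) else
        Real.exp (-(‖(s : EuclideanSpace ℝ (Fin 3))‖ ^ 2) / L t ^ 2) ^ 2) /
      ∑' s : Λ, Real.exp (-(‖(s : EuclideanSpace ℝ (Fin 3))‖ ^ 2) / L t ^ 2) ^ 2) atTop (𝓝 0) := by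
  rw [Metric.tendsto_nhds]
  intro ε hε
  /- 1. Parameters: the scale `A` (packing constant `τ(r,A) ≤ ε/16`), the auxiliary scale
  `B = √2 A` with its constant `C_B = B³(1 + τ(r,B))`, the radius `R` (Gaussian tail) and the
  width `ρ` of the neighbourhood of the periodised Bragg set. -/
  have hε16 : 0 < ε / 16 := by positivity
  obtain ⟨A, hA1, hτA⟩ := exists_scale_tau_le hr hε16
  have hA : 0 < A := by linarith
  have hA3 : 0 < A ^ 3 := by positivity
  obtain ⟨B, hBdef⟩ : ∃ B : ℝ, B = Real.sqrt 2 * A := ⟨_, rfl⟩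
  have hB : 0 < B := by rw [hBdef]; positivity
  have hB2 : B ^ 2 = 2 * A ^ 2 := by rw [hBdef, mul_pow, Real.sq_sqrt (by norm_num)]
  obtain ⟨CB, hCBdef⟩ : ∃ CB : ℝ, CB = B ^ 3 * (1 + Real.exp (-(Real.pi * B ^ 2 * r ^ 2 / 2)) *
      (2 * (2 / r + 1) ^ 3 * (8 / B ^ 2 + 1) ^ 3)) := ⟨_, rfl⟩
  have hCB0 : 0 < CB := by rw [hCBdef]; positivity
  obtain ⟨R, hR0, hR⟩ := exists_radius_mul_exp_le hB (2 * CB) (ε := ε / 16 * A ^ 3) (by positivity)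
  obtain ⟨Qc, hQcdef⟩ : ∃ Qc : ℝ,
      Qc = 2 * Real.pi ^ 2 * ‖z₀‖ ^ 2 * Real.exp (Real.pi * R ^ 2 / B ^ 2) * CB := ⟨_, rfl⟩
  have hQc0 : 0 ≤ Qc := by rw [hQcdef]; positivity
  obtain ⟨ρ, hρdef⟩ : ∃ ρ : ℝ, ρ = min 1 (ε / 16 * A ^ 3 / (Qc + 1)) := ⟨_, rfl⟩
  have hρ0 : 0 < ρ := by rw [hρdef]; exact lt_min one_pos (by positivity)
  have hρ1 : ρ ≤ 1 := by rw [hρdef]; exact min_le_left _ _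
  have hρQ : ρ ^ 2 * Qc ≤ ε / 16 * A ^ 3 := by
    have h1 : ρ ≤ ε / 16 * A ^ 3 / (Qc + 1) := by rw [hρdef]; exact min_le_right _ _
    have h2 : ρ * (Qc + 1) ≤ ε / 16 * A ^ 3 := by rwa [le_div_iff₀ (by positivity)] at h1
    have h3 : ρ ^ 2 ≤ ρ := by nlinarith
    have h4 : ρ ^ 2 * Qc ≤ ρ * Qc := mul_le_mul_of_nonneg_right h3 hQc0
    have h5 : ρ * Qc ≤ ρ * (Qc + 1) := by nlinarith
    linarith
  obtain ⟨η, hηdef⟩ : ∃ η : ℝ, η = 2 * Real.exp (-(Real.pi * R ^ 2 / B ^ 2)) +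
      2 * Real.pi ^ 2 * ρ ^ 2 * ‖z₀‖ ^ 2 * Real.exp (Real.pi * R ^ 2 / B ^ 2) := ⟨_, rfl⟩
  have hη0 : 0 ≤ η := by rw [hηdef]; positivity
  have hηCB : η * CB ≤ ε / 16 * A ^ 3 + ε / 16 * A ^ 3 := by
    have : η * CB = 2 * CB * Real.exp (-(Real.pi * R ^ 2 / B ^ 2)) + ρ ^ 2 * Qc := by
      rw [hηdef, hQcdef]; ring
    rw [this]
    exact add_le_add hR hρQ
  rw [hCBdef] at hηCB
  /- 2. The periodised Bragg set `K`, the cutoff `χ` and the test function `g`. -/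
  obtain ⟨K, hKdef⟩ : ∃ K : Set (EuclideanSpace ℝ (Fin 3)), K = {ξ | ∀ m ∈ V, ¬ (ξ + m ≠ 0 ∧
      ∀ k : EuclideanSpace ℝ (Fin 3), (∀ v ∈ P.lattice, ∃ n : ℤ, ⟪k, v⟫ = (n : ℝ)) → ‖ξ + m‖ ≠ ‖k‖)} :=
    ⟨_, rfl⟩
  have hK : ∀ κ ∈ K, ∃ n : ℤ, ⟪κ, z₀⟫ = n := fun κ hκ => harith κ (by rw [hKdef] at hκ; exact hκ)
  obtain ⟨χ, hχc, hχs, hχ01, hχ1, hχK⟩ := exists_cutoff_avoiding K R hρ0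
  have hdom := gauss_modulation_remainder_le hA hB hB2 hR0 hK hχ01 hχ1
  rw [← hηdef] at hdom
  obtain ⟨g, hgdef⟩ : ∃ g : EuclideanSpace ℝ (Fin 3) → ℝ, g = fun ξ =>
      Real.exp (-(Real.pi / A ^ 2) * ‖ξ‖ ^ 2) * (1 - Real.cos (2 * Real.pi * ⟪ξ, z₀⟫)) * χ ξ :=
    ⟨_, rfl⟩
  have hgc : Continuous g := by rw [hgdef]; fun_prop
  have hgs : HasCompactSupport g := by rw [hgdef]; exact hχs.mul_left
  have hgadm : ∀ ξ ∈ tsupport g, ∃ m ∈ V, ξ + m ≠ 0 ∧ ∀ k : EuclideanSpace ℝ (Fin 3),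
      (∀ v ∈ P.lattice, ∃ n : ℤ, ⟪k, v⟫ = (n : ℝ)) → ‖ξ + m‖ ≠ ‖k‖ := by
    intro ξ hξ
    have hξK : ξ ∉ K := hχK ξ (by rw [hgdef] at hξ; exact tsupport_mul_subset_right hξ)
    rw [hKdef] at hξK
    simp only [Set.mem_setOf_eq, not_forall, not_not] at hξK
    obtain ⟨m, hm, h⟩ := hξK
    exact ⟨m, hm, h⟩
  have hgq := eventually_abs_integral_le_of_shift hr hΛ hL hquiet hV hgc hgs hgadm
    (ε := ε / 16 * A ^ 3) (by positivity)
  /- 3. Along the scales. -/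
  filter_upwards [hgq, hL.eventually_gt_atTop 0] with t hgt hLt
  have hc0 : ∀ z : EuclideanSpace ℝ (Fin 3), 0 ≤ Real.exp (-(‖z‖ ^ 2) / L t ^ 2) := fun z =>
    (Real.exp_pos _).le
  have hcs : Summable fun s : Λ => Real.exp (-(‖(s : EuclideanSpace ℝ (Fin 3))‖ ^ 2) / L t ^ 2) :=
    (summable_gauss hr hΛ hLt).1
  simp only [hgdef] at hgt
  have hbad := bad_le_of_bounds hr hΛ hc0 hcs hz₀ hA hB hη0 hτA hηCB hχc hχ01 hdom hgt
  obtain ⟨MG, hMGdef⟩ : ∃ MG : ℝ,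
      MG = ∑' s : Λ, Real.exp (-(‖(s : EuclideanSpace ℝ (Fin 3))‖ ^ 2) / L t ^ 2) ^ 2 := ⟨_, rfl⟩
  obtain ⟨BAD, hBADdef⟩ : ∃ BAD : ℝ, BAD = ∑' s : Λ, if (s : EuclideanSpace ℝ (Fin 3)) + z₀ ∈ Λ
      then (0 : ℝ) else Real.exp (-(‖(s : EuclideanSpace ℝ (Fin 3))‖ ^ 2) / L t ^ 2) ^ 2 := ⟨_, rfl⟩
  rw [← hMGdef, ← hBADdef] at hbad ⊢
  have hMG0 : 0 ≤ MG := by rw [hMGdef]; exact tsum_nonneg fun s => sq_nonneg _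
  have hBAD0 : 0 ≤ BAD := by rw [hBADdef]; exact tsum_nonneg fun s => by positivity
  rw [Real.dist_eq, sub_zero]
  rcases hMG0.eq_or_lt with hMG | hMG
  · rw [← hMG, div_zero, abs_zero]; exact hε
  · rw [abs_of_nonneg (div_nonneg hBAD0 hMG0), div_lt_iff₀ hMG]
    have : 0 < ε * MG := mul_pos hε hMG
    linarith

end HcpRigiditySpectral

open scoped Classical in
open Filter HcpRigiditySpectral in
/-- **Registered stub B2b₀ of the skeleton: essential periodicity from quietness, periods and
arithmetic (lattice form).** Let `Λ` be `δ`-separated inside a discrete `ℤ`-module `M` of `ℝ³`,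
Gaussian-quiet along `L t → ∞` off the Bragg set of a periodic template `P`; let `V` be a set of
periods of `|S_t|²` (`⟨m, s⟩ ∈ ℤ`), and suppose every `ξ` all of whose `V`-translates lie in the
Bragg set pairs `(1/k)`-integrally with `M`. Then `Λ` is essentially periodic under the finite-index
submodule `M' = k • M`: for every `z ∈ M'` the squared-Gaussian mass of `{s ∈ Λ : s + z ∉ Λ}` is
`o(`total squared-Gaussian mass`)` along `L t`. [folklore] -/
theorem stub_essentialPeriodicityOfArith : ∀ (P : Literature.MathematicalPhysics.StatisticalMechanics.PeriodicConfiguration 3) (δ : ℝ), 0 < δ → ∀ Λ : Set (EuclideanSpace ℝ (Fin 3)), (∀ p ∈ Λ, ∀ q ∈ Λ, p ≠ q → δ ≤ dist p q) → ∀ M : Submodule ℤ (EuclideanSpace ℝ (Fin 3)), DiscreteTopology M → Λ ⊆ M → ∀ L : ℕ → ℝ, Filter.Tendsto L Filter.atTop Filter.atTop → (∀ g : EuclideanSpace ℝ (Fin 3) → ℝ, Continuous g → HasCompactSupport g → (∀ ξ ∈ tsupport g, ξ ≠ 0 ∧ ∀ k : EuclideanSpace ℝ (Fin 3), (∀ v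 ∈ P.lattice, ∃ n : ℤ, inner ℝ k v = (n : ℝ)) → ‖ξ‖ ≠ ‖k‖) → ∀ ε : ℝ, 0 < ε → ∀ᶠ t : ℕ in Filter.atTop, (∫ ξ, g ξ * ‖∑' s : Λ, (Real.exp (-(‖(s : EuclideanSpace ℝ (Fin 3))‖ ^ 2) / L t ^ 2) : ℂ) * Complex.exp (2 * Real.pi * Complex.I * (inner ℝ ξ (s : EuclideanSpace ℝ (Fin 3)) : ℂ))‖ ^ 2) ≤ ε * ∑' s : Λ, Real.exp (-(‖(s : EuclideanSpace ℝ (Fin 3))‖ ^ 2) / L t ^ 2) ^ 2) → ∀ V : Set (EuclideanSpace ℝ (Fin 3)), (∀ m ∈ V, ∀ s ∈ Λ, ∃ n : ℤ, inner ℝ m s = (n : ℝ)) → ∀ k : ℕ, 0 < k → (∀ ξ : EuclideanSpace ℝ (Fin 3), (∀ m ∈ V, ¬ (ξ + m ≠ 0 ∧ ∀ k' : EuclideanSpace ℝ (Fin 3), (∀ v ∈ P.lattice, ∃ n : ℤ, inner ℝ k' v = (n : ℝ)) → ‖ξ + m‖ ≠ ‖k'‖)) → ∀ z ∈ M, ∃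 n : ℤ, (k : ℝ) * inner ℝ ξ z = (n : ℝ)) → ∃ (M' : Submodule ℤ (EuclideanSpace ℝ (Fin 3))) (k' : ℕ), 0 < k' ∧ M' ≤ M ∧ (∀ z ∈ M, (k' : ℤ) • z ∈ M') ∧ ∀ z ∈ M', Filter.Tendsto (fun t : ℕ => (∑' s : Λ, if (s : EuclideanSpace ℝ (Fin 3)) + z ∈ Λ then (0 : ℝ) else Real.exp (-(‖(s : EuclideanSpace ℝ (Fin 3))‖ ^ 2) / L t ^ 2) ^ 2) / ∑' s : Λ, Real.exp (-(‖(s : EuclideanSpace ℝ (Fin 3))‖ ^ 2) / L t ^ 2) ^ 2) Filter.atTop (nhds 0) := by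
  intro P δ _hδ Λ _hsep M hMd hΛM L hL hquiet V hV k hk harith
  haveI := hMd
  obtain ⟨r, hr, hrM⟩ := exists_pos_le_norm_of_discrete M
  -- `Λ ⊆ M` is `r`-separated
  have hΛr : ∀ p ∈ Λ, ∀ q ∈ Λ, p ≠ q → r ≤ dist p q := fun p hp q hq hpq => by
    rw [dist_eq_norm]
    exact hrM (p - q) (M.sub_mem (hΛM hp) (hΛM hq)) (sub_ne_zero.2 hpq)
  refine ⟨M.map ((k : ℤ) • LinearMap.id), k, hk, fun x hx => ?_, fun z hz => ?_, fun z hz => ?_⟩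
  · obtain ⟨y, hy, rfl⟩ := Submodule.mem_map.1 hx
    simpa using M.smul_mem (k : ℤ) hy
  · exact Submodule.mem_map.2 ⟨z, hz, by simp⟩
  · obtain ⟨y, hy, rfl⟩ := Submodule.mem_map.1 hz
    have hky : ((k : ℤ) • LinearMap.id : EuclideanSpace ℝ (Fin 3) →ₗ[ℤ] EuclideanSpace ℝ (Fin 3)) y =
        (k : ℝ) • y := by
      simp [← Int.cast_smul_eq_zsmul ℝ]
    rw [hky]
    have hkyM : (k : ℝ) • y ∈ M := by
      rw [show (k : ℝ) • y = ((k : ℤ) : ℝ) • y by norm_cast, Int.cast_smul_eq_zsmul]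
      exact M.smul_mem _ hy
    refine tendsto_bad_div_mass hr hΛr hL hquiet hV (fun p hp q hq hpq => ?_) (fun ξ hξ => ?_)
    · exact hrM _ (M.sub_mem (M.sub_mem (hΛM hp) (hΛM hq)) hkyM) hpq
    · obtain ⟨n, hn⟩ := harith ξ hξ y hy
      exact ⟨n, by rw [real_inner_smul_right, hn]⟩

end Summit.AtomisticToContinuum.Crystallization.Theorems

end
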